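import Summits.BirchSwinnertonDyer.BirchSwinnertonDyer.Theorems.PrintCf2DisegniPairTwoChiLineFactorisation
import Literature.NumberTheory.EllipticCurves.NonEisensteinPrimeOfSurjective
import Literature.NumberTheory.EllipticCurves.CuspFormLFunctionLevelConductorProofs
import Mathlib.RingTheory.PowerSeries.Derivative
import HarnessLib

/-!
# Road (C) `disegni-pair-two` on crux stmt-BirchSwinnertonDyer-20368 — the factorisation READ OFF: values,
# constant term and FIRST COEFFICIENT of Disegni's function on the `χ₈ ∘ N`-line at `p = 2`
# (`[T¹]G = −c · L₂′(E, −2) · L₂(E^{(d_K)}, −2)` when `L₂(E, −2) = 0`)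

Cell `bsd-print-cf2`, width seat `bsd-line-cf2-p1-w8` g21; fifth file of the `p = 2` factorisation chain,
consumer-facing corollaries of `chi8Line_eq_C_mul_map` (`…ChiLineFactorisation`):
`G(T) = c · L₂(E,−T−2) · L₂(E′,−T−2)`. THEOREMS ONLY (no `def`, no named fact, no `sorry`);
`--supports stmt-BirchSwinnertonDyer-20368`. BSD is not proved by any of this.

* `hasLineValueAt_chi8Line` — `G(z) = c · L₂(E, −2−z) · L₂(E′, −2−z)` for all `z ∈ ℂ₂`, `‖z‖ < 1`
  (values as `HasSum`s of the two Mazur–Tate–Teitelbaum series at `−2−z`);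
* `constantCoeff_chi8Line_eq` — `G(0) = c · L₂(E, −2) · L₂(E′, −2)`: Theorem A's value at the base point
  `χ₈∘N` (where `L(E/K, χ₈∘N, 1) = L(E^{(2)},1)·L(E^{(2d_K)},1)`) is the product of the two MTT functions at
  the conductor-`8` point `T = −2`;
* `coeff_one_chi8Line_eq` — `[T¹]G = −c · Σ_k k·P_k·(−2)^{k−1}` (`P = L₂(E,T)L₂(E′,T)`; `= −c·P′(−2)`);
* `coeff_one_chi8Line_eq_of_hasSum_zero` — **if `L₂(E, −2) = 0`** (the sign-forced zero of the `2`-adic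
  `L`-function of `E` at the conductor-`8` character when `L(E^{(2)}, 1) = 0`, cf.
  `hasSum_coeff_padicLFunction_two_neg_two_zero` of `PAdicLFunctionZeroAtMinusTwoProofs`) **then
  `[T¹]G = −c · L₂′(E, −2) · L₂(E′, −2)`** with `L₂′(E,−2) = Σ_k k·[T^k]L₂(E,T)·(−2)^{k−1}` — Leibniz for
  `P′ = L₂(E,·)•L₂(E′,·)′ + L₂(E′,·)•L₂(E,·)′` (Mathlib `PowerSeries.derivativeFun_mul`) evaluated at `−2`
  (`MemIwasawaRat.hasSum_eval_mul`). This is the exact form of the planner's law «ord₂ G′_χ(0) = D + a»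
  (PREGRADE §5): `D = ord₂ L₂′(E,−2)`, `a = ord₂ L₂(E′,−2)`, up to `ord₂ c`.

For road (C), `d* = 2`: `E = V_{d′} = 49a1^{(d′)}` (`d′ ≡ 1 mod 4`, good ordinary at `2`), `W = E^{(2)}`
the ADDITIVE member, `K = E′` the auxiliary Heegner field (`2` split), `E′ := E^{(d_K)}`; the left side
`[T¹]G` is what Disegni's Theorem B (`Disegni2017.ChiLineGrossZagierClauses`, typer (U5b′)) expresses
through the `2`-adic height of the Heegner point.

References: [Disegni2017] Thm. A/B (arXiv v3 PDF pp. 6–9); [MazurTateTeitelbaum1986Invent] §I.11–I.14;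
[PerrinRiou1987] (1.1); [Robert2000] Ch. 6 §1.5; cell PREGRADE `bsd-print-cf2-plan/PREGRADE-disegni-pair-two-skeleton-g24.md` §5.
-/

set_option autoImplicit false
set_option linter.dupNamespace false

noncomputable section

open scoped Classical MatrixGroups ModularForm NumberField

open CongruenceSubgroup NumberField IsDedekindDomain WeierstrassCurve Literature.NumberTheory.EllipticCurves
  Literature.NumberTheory.EllipticCurves.ModularForms
  Literature.NumberTheory.EllipticCurves.Disegni2017 Literature.NumberTheory.GaloisRepresentations
  Summit.BirchSwinnertonDyer.Rank1Residual.Additive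

namespace Summit.BirchSwinnertonDyer.BirchSwinnertonDyer.Theorems.PrintCf2.DisegniPairTwo

section LeadingCoeff

/-! ### §0 Evaluation plumbing over `ℚ₂` -/

/-- A series with bounded coefficients converges at a point of the open unit disc of `ℚ_p`. [folklore] -/
private theorem summable_coeff_mul_pow_of_le {p : ℕ} [Fact p.Prime] {F : PowerSeries ℚ_[p]} {C : ℝ}
    (hF : ∀ k, ‖PowerSeries.coeff k F‖ ≤ C) {a : ℚ_[p]} (ha : ‖a‖ < 1) :
    Summable (fun k : ℕ ↦ PowerSeries.coeff k F * a ^ k) := by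
  refine Summable.of_norm_bounded ((summable_geometric_of_lt_one (norm_nonneg _) ha).mul_left C)
    fun k ↦ ?_
  rw [norm_mul, norm_pow]
  exact mul_le_mul_of_nonneg_right (hF k) (pow_nonneg (norm_nonneg _) _)

/-- Transport of an evaluation from `ℚ_p` to `ℂ_p` along the (continuous) embedding. [folklore] -/
private theorem hasSum_algebraMap_coeff_mul_pow {p : ℕ} [Fact p.Prime] {F : PowerSeries ℚ_[p]}
    {a s : ℚ_[p]} (h : HasSum (fun k : ℕ ↦ PowerSeries.coeff k F * a ^ k) s) :
    HasSum (fun k : ℕ ↦ algebraMap ℚ_[p] ℂ_[p] (PowerSeries.coeff k F) * (algebraMap ℚ_[p] ℂ_[p] a) ^ k)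
      (algebraMap ℚ_[p] ℂ_[p] s) := by
  have h' := h.map (algebraMap ℚ_[p] ℂ_[p]) (continuous_algebraMap ℚ_[p] ℂ_[p])
  refine h'.congr_fun fun k ↦ ?_
  simp only [Function.comp_apply, map_mul, map_pow]

/-- The formal derivative of a bounded series is bounded (`‖n+1‖ ≤ 1`). [folklore] -/
private theorem norm_coeff_derivativeFun_le {p : ℕ} [Fact p.Prime] {F : PowerSeries ℚ_[p]} {C : ℝ}
    (hF : ∀ k, ‖PowerSeries.coeff k F‖ ≤ C) (n : ℕ) :
    ‖PowerSeries.coeff n F.derivativeFun‖ ≤ C := by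
  have hC : 0 ≤ C := (norm_nonneg _).trans (hF 0)
  rw [PowerSeries.coeff_derivativeFun, norm_mul, show ((n : ℚ_[p]) + 1) = ((n + 1 : ℕ) : ℚ_[p]) by
    push_cast; ring]
  calc ‖PowerSeries.coeff (n + 1) F‖ * ‖((n + 1 : ℕ) : ℚ_[p])‖ ≤ C * 1 :=
        mul_le_mul (hF _) (IsUltrametricDist.norm_natCast_le_one ℚ_[p] _) (norm_nonneg _) hC
    _ = C := mul_one C

/-- **Re-indexing the derivative**: `Σ_k k·F_k·a^{k−1} = Σ_n [Tⁿ]F′ · aⁿ` (`[Tⁿ]F′ = (n+1)F_{n+1}`; the `k = 0`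
term vanishes). [folklore] -/
private theorem hasSum_derivativeFun_iff {p : ℕ} [Fact p.Prime] {F : PowerSeries ℚ_[p]} {a s : ℚ_[p]} :
    HasSum (fun n : ℕ ↦ PowerSeries.coeff n F.derivativeFun * a ^ n) s ↔
      HasSum (fun k : ℕ ↦ PowerSeries.coeff k F * (k : ℚ_[p]) * a ^ (k - 1)) s := by
  have h := hasSum_nat_add_iff (f := fun k : ℕ ↦ PowerSeries.coeff k F * (k : ℚ_[p]) * a ^ (k - 1)) 1
    (g := s)
  simp only [Finset.sum_range_one, Nat.cast_zero, mul_zero, zero_mul, add_zero] at h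
  rw [← h]
  have hfun : (fun n : ℕ ↦ PowerSeries.coeff n F.derivativeFun * a ^ n) =
      fun n : ℕ ↦ PowerSeries.coeff (n + 1) F * (((n + 1 : ℕ)) : ℚ_[p]) * a ^ (n + 1 - 1) := by
    funext n
    rw [PowerSeries.coeff_derivativeFun, Nat.cast_succ, Nat.add_sub_cancel]
  rw [hfun]

/-- **The level of the newform of a curve good at `2` is odd** (Carayol: the level is the conductor,
read prime by prime via `IsNewformOf.dvd_level_iff_dvd_conductorNorm`; a prime of good reduction does not
divide the conductor, Silverman ATAEC IV.10.2(a), `not_dvd_conductorNorm_of_hasGoodReductionAtPrime`) —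
the binder `2 ∤ N` of the factorisation theorems, discharged. [cite: Carayol1986] [cite: Silverman1994, IV.10.2(a)] -/
theorem not_two_dvd_level_of_isOrdinaryAt {V : WeierstrassCurve ℚ} [V.IsElliptic] [V.IsGloballyMinimal]
    {N : ℕ} [NeZero N] {f : CuspForm (Gamma0 N) 2} (hfV : IsNewformOf V f) (hord : IsOrdinaryAt V 2) :
    ¬ 2 ∣ N :=
  fun h ↦ not_dvd_conductorNorm_of_hasGoodReductionAtPrime V hord.1
    ((hfV.dvd_level_iff_dvd_conductorNorm Nat.prime_two).mp h)

variable (ι : PadicAlgCl 2 ≃+* ℂ) (K : Type) [Field K] [NumberField K] [IsGalois ℚ K]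

/-- `ι₂(−2) = −2`. [folklore] -/
private theorem algebraMap_neg_two' : algebraMap ℚ_[2] ℂ_[2] (-2) = -2 := by
  rw [map_neg, map_ofNat]

/-- `‖−2‖₂ < 1`. [folklore] -/
private theorem norm_neg_two_lt_one' : ‖(-2 : ℚ_[2])‖ < 1 := by
  rw [norm_neg, show (2 : ℚ_[2]) = ((2 : ℕ) : ℚ_[2]) by norm_num, Padic.norm_p]
  norm_num

/-- `‖−2 − z‖ < 1` for `‖z‖ < 1` in `ℂ₂`. [folklore] -/
private theorem norm_neg_two_sub_lt_one {z : ℂ_[2]} (hz : ‖z‖ < 1) : ‖(-2 - z : ℂ_[2])‖ < 1 := by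
  rw [← algebraMap_neg_two', sub_eq_add_neg]
  refine lt_of_le_of_lt (IsUltrametricDist.norm_add_le_max _ _) (max_lt ?_ (by rwa [norm_neg]))
  rw [norm_algebraMap']; exact norm_neg_two_lt_one'

/-! ### §1 Values and the constant term -/

/-- ★ **`G(z) = c · L₂(E, −2−z) · L₂(E′, −2−z)` on the open disc** (setting of
`chi8Line_eq_C_mul_map`): for `z ∈ ℂ₂`, `‖z‖ < 1`, and `e₁ = Σ_k ι₂([T^k]L₂(E,T))(−2−z)^k`,
`e₂ = Σ_k ι₂([T^k]L₂(E′,T))(−2−z)^k`, Disegni's line function has the value `c·e₁·e₂` at `z`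
(`HasLineValueAt`). [cite: Disegni2017, Theorem A (arXiv v3 PDF pp. 6–8)]
[cite: MazurTateTeitelbaum1986Invent, §I.13–I.14] [cite: PerrinRiou1987, (1.1) (p. 459)] -/
theorem hasLineValueAt_chi8Line (h2 : Module.finrank ℚ K = 2)
    (hsplit : ((Ideal.span {(2 : ℤ)}).primesOver (𝓞 K)).ncard = 2)
    (𝔭 𝔭' : HeightOneSpectrum (𝓞 K)) (h𝔭 : ((2 : ℕ) : 𝓞 K) ∈ 𝔭.asIdeal)
    (h𝔭' : ((2 : ℕ) : 𝓞 K) ∈ 𝔭'.asIdeal)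
    (κ : DirichletCharacter ℂ (NumberField.discr K).natAbs)
    (hκ : ∀ ℓ : ℕ, ℓ.Prime → ℓ ≠ 2 → κ ℓ = (jacobiSym (NumberField.discr K) ℓ : ℂ))
    (hκ2 : κ 2 = if NumberField.discr K % 8 = 1 then 1
        else if NumberField.discr K % 8 = 5 then -1 else 0)
    (hd : Nat.Coprime 2 (NumberField.discr K).natAbs)
    (V V' : WeierstrassCurve ℚ) [V.IsElliptic] [V.IsGloballyMinimal] [V'.IsElliptic] [V'.IsGloballyMinimal]
    (hordV : IsOrdinaryAt V 2) (hordV' : IsOrdinaryAt V' 2) (hap : V'.frobeniusTrace 2 = V.frobeniusTrace 2)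
    {N N' : ℕ} [NeZero N] [NeZero N'] (hN : ¬ 2 ∣ N) {f : CuspForm (Gamma0 N) 2}
    {f' : CuspForm (Gamma0 N') 2} (hfV : IsNewformOf V f) (hfV' : IsNewformOf V' f')
    (hV' : ∀ n : ℕ, cuspCoeff f' n = κ (n : ZMod _) * cuspCoeff f n)
    {Car : ℝ} {G : PowerSeries ℂ_[2]}
    (hG : ChiLineInterpolation ι K f (ι (((unitRoot V 2 : ℚ_[2]) : PadicAlgCl 2)))
      (baseChangeDirichlet K (ZMod.χ₈.ringHomComp (Int.castRingHom ℂ))) 𝔭 𝔭' Car G)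
    {z : ℂ_[2]} (hz : ‖z‖ < 1) {e₁ e₂ : ℂ_[2]}
    (he₁ : HasSum (fun k : ℕ ↦ algebraMap ℚ_[2] ℂ_[2]
      (PowerSeries.coeff k (padicLFunction f (unitRoot V 2 : ℚ_[2]))) * (-2 - z) ^ k) e₁)
    (he₂ : HasSum (fun k : ℕ ↦ algebraMap ℚ_[2] ℂ_[2]
      (PowerSeries.coeff k (padicLFunction f' (unitRoot V 2 : ℚ_[2]))) * (-2 - z) ^ k) e₂) :
    HasLineValueAt G z
      (((ι.symm ((splitLocalConstant 2 : ℂ) * (Car : ℂ) * (plusPeriod f : ℂ) * (plusPeriod f' : ℂ)) :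
          PadicAlgCl 2) : ℂ_[2]) * e₁ * e₂) := by
  obtain ⟨H, hGH, -, -, hHev⟩ := chi8Line_eq_C_mul_map ι K h2 hsplit 𝔭 𝔭' h𝔭 h𝔭' κ hκ hκ2 hd V V' hordV
    hordV' hap hN hfV hfV' hV' hG
  have hα' : (unitRoot V' 2 : ℚ_[2]) = (unitRoot V 2 : ℚ_[2]) := by
    rw [show unitRoot V' 2 = unitRoot V 2 by unfold unitRoot; rw [hap]]
  obtain ⟨C₁, hC₁⟩ := exists_forall_norm_coeff_padicLFunction_le (f := f) hordV hfV
  obtain ⟨C₂, hC₂⟩ := exists_forall_norm_coeff_padicLFunction_le (f := f') hordV' hfV'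
  rw [hα'] at hC₂
  have hprod := MemIwasawaRat.hasSum_eval_mul (memIwasawaRat_of_forall_norm_coeff_le hC₁)
    (memIwasawaRat_of_forall_norm_coeff_le hC₂) (norm_neg_two_sub_lt_one hz) he₁ he₂
  have hH := hHev z hz
  rw [hprod.tsum_eq] at hH
  have hcoeff : ∀ j, PowerSeries.coeff j G =
      ((ι.symm ((splitLocalConstant 2 : ℂ) * (Car : ℂ) * (plusPeriod f : ℂ) * (plusPeriod f' : ℂ)) :
          PadicAlgCl 2) : ℂ_[2]) * algebraMap ℚ_[2] ℂ_[2] (PowerSeries.coeff j H) := by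
    intro j
    rw [hGH, PowerSeries.coeff_C_mul, PowerSeries.coeff_map]
  unfold HasLineValueAt
  have hfun : (fun j : ℕ ↦ PowerSeries.coeff j G * z ^ j) = fun j : ℕ ↦
      ((ι.symm ((splitLocalConstant 2 : ℂ) * (Car : ℂ) * (plusPeriod f : ℂ) * (plusPeriod f' : ℂ)) :
          PadicAlgCl 2) : ℂ_[2]) * (algebraMap ℚ_[2] ℂ_[2] (PowerSeries.coeff j H) * z ^ j) := by
    funext j
    rw [hcoeff, mul_assoc]
  rw [hfun]
  simpa only [mul_assoc] using hH.mul_left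
    (((ι.symm ((splitLocalConstant 2 : ℂ) * (Car : ℂ) * (plusPeriod f : ℂ) * (plusPeriod f' : ℂ)) :
      PadicAlgCl 2) : ℂ_[2]))

/-- ★ **`G(0) = c · L₂(E, −2) · L₂(E′, −2)`**: the constant coefficient of Disegni's function on the
`χ₈∘N`-line — Theorem A AT `χ₈∘N`, i.e. `ι⁻¹(Z°₂(χ₈∘N)·Car·L(1/2, σ_{E,K} ⊗ χ₈∘N))` — is `c` times the two
Mazur–Tate–Teitelbaum functions at the conductor-`8` point `T = −2`.
[cite: Disegni2017, Theorem A (arXiv v3 PDF pp. 6–8)] [cite: MazurTateTeitelbaum1986Invent, §I.14 (14.3)] -/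
theorem constantCoeff_chi8Line_eq (h2 : Module.finrank ℚ K = 2)
    (hsplit : ((Ideal.span {(2 : ℤ)}).primesOver (𝓞 K)).ncard = 2)
    (𝔭 𝔭' : HeightOneSpectrum (𝓞 K)) (h𝔭 : ((2 : ℕ) : 𝓞 K) ∈ 𝔭.asIdeal)
    (h𝔭' : ((2 : ℕ) : 𝓞 K) ∈ 𝔭'.asIdeal)
    (κ : DirichletCharacter ℂ (NumberField.discr K).natAbs)
    (hκ : ∀ ℓ : ℕ, ℓ.Prime → ℓ ≠ 2 → κ ℓ = (jacobiSym (NumberField.discr K) ℓ : ℂ))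
    (hκ2 : κ 2 = if NumberField.discr K % 8 = 1 then 1
        else if NumberField.discr K % 8 = 5 then -1 else 0)
    (hd : Nat.Coprime 2 (NumberField.discr K).natAbs)
    (V V' : WeierstrassCurve ℚ) [V.IsElliptic] [V.IsGloballyMinimal] [V'.IsElliptic] [V'.IsGloballyMinimal]
    (hordV : IsOrdinaryAt V 2) (hordV' : IsOrdinaryAt V' 2) (hap : V'.frobeniusTrace 2 = V.frobeniusTrace 2)
    {N N' : ℕ} [NeZero N] [NeZero N'] (hN : ¬ 2 ∣ N) {f : CuspForm (Gamma0 N) 2}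
    {f' : CuspForm (Gamma0 N') 2} (hfV : IsNewformOf V f) (hfV' : IsNewformOf V' f')
    (hV' : ∀ n : ℕ, cuspCoeff f' n = κ (n : ZMod _) * cuspCoeff f n)
    {Car : ℝ} {G : PowerSeries ℂ_[2]}
    (hG : ChiLineInterpolation ι K f (ι (((unitRoot V 2 : ℚ_[2]) : PadicAlgCl 2)))
      (baseChangeDirichlet K (ZMod.χ₈.ringHomComp (Int.castRingHom ℂ))) 𝔭 𝔭' Car G)
    {e₁ e₂ : ℂ_[2]}
    (he₁ : HasSum (fun k : ℕ ↦ algebraMap ℚ_[2] ℂ_[2]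
      (PowerSeries.coeff k (padicLFunction f (unitRoot V 2 : ℚ_[2]))) * (-2) ^ k) e₁)
    (he₂ : HasSum (fun k : ℕ ↦ algebraMap ℚ_[2] ℂ_[2]
      (PowerSeries.coeff k (padicLFunction f' (unitRoot V 2 : ℚ_[2]))) * (-2) ^ k) e₂) :
    PowerSeries.constantCoeff G =
      ((ι.symm ((splitLocalConstant 2 : ℂ) * (Car : ℂ) * (plusPeriod f : ℂ) * (plusPeriod f' : ℂ)) :
          PadicAlgCl 2) : ℂ_[2]) * e₁ * e₂ := by
  have he₁' : HasSum (fun k : ℕ ↦ algebraMap ℚ_[2] ℂ_[2]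
      (PowerSeries.coeff k (padicLFunction f (unitRoot V 2 : ℚ_[2]))) * (-2 - (0 : ℂ_[2])) ^ k) e₁ := by
    simpa only [sub_zero] using he₁
  have he₂' : HasSum (fun k : ℕ ↦ algebraMap ℚ_[2] ℂ_[2]
      (PowerSeries.coeff k (padicLFunction f' (unitRoot V 2 : ℚ_[2]))) * (-2 - (0 : ℂ_[2])) ^ k) e₂ := by
    simpa only [sub_zero] using he₂
  have h := hasLineValueAt_chi8Line ι K h2 hsplit 𝔭 𝔭' h𝔭 h𝔭' κ hκ hκ2 hd V V' hordV hordV' hap hN hfV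
    hfV' hV' hG (by rw [norm_zero]; exact one_pos) he₁' he₂'
  exact (HasLineValueAt.eq_constantCoeff h).symm

/-! ### §2 The first coefficient -/

/-- ★ **`[T¹]G = −c · Σ_k k·P_k·(−2)^{k−1} = −c · P′(−2)`**, `P = L₂(E,T)·L₂(E′,T)`: the derivative of
Disegni's line function at the base point `χ₈∘N` is `−c` times the derivative of the product of the
two Mazur–Tate–Teitelbaum functions at `T = −2` (chain rule for `T ↦ −T−2`).
[cite: Disegni2017, Theorem A (arXiv v3 PDF pp. 6–8)] [cite: MazurTateTeitelbaum1986Invent, §I.13–I.14]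
[cite: Robert2000, Ch. 6 §1.5] -/
theorem coeff_one_chi8Line_eq (h2 : Module.finrank ℚ K = 2)
    (hsplit : ((Ideal.span {(2 : ℤ)}).primesOver (𝓞 K)).ncard = 2)
    (𝔭 𝔭' : HeightOneSpectrum (𝓞 K)) (h𝔭 : ((2 : ℕ) : 𝓞 K) ∈ 𝔭.asIdeal)
    (h𝔭' : ((2 : ℕ) : 𝓞 K) ∈ 𝔭'.asIdeal)
    (κ : DirichletCharacter ℂ (NumberField.discr K).natAbs)
    (hκ : ∀ ℓ : ℕ, ℓ.Prime → ℓ ≠ 2 → κ ℓ = (jacobiSym (NumberField.discr K) ℓ : ℂ))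
    (hκ2 : κ 2 = if NumberField.discr K % 8 = 1 then 1
        else if NumberField.discr K % 8 = 5 then -1 else 0)
    (hd : Nat.Coprime 2 (NumberField.discr K).natAbs)
    (V V' : WeierstrassCurve ℚ) [V.IsElliptic] [V.IsGloballyMinimal] [V'.IsElliptic] [V'.IsGloballyMinimal]
    (hordV : IsOrdinaryAt V 2) (hordV' : IsOrdinaryAt V' 2) (hap : V'.frobeniusTrace 2 = V.frobeniusTrace 2)
    {N N' : ℕ} [NeZero N] [NeZero N'] (hN : ¬ 2 ∣ N) {f : CuspForm (Gamma0 N) 2}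
    {f' : CuspForm (Gamma0 N') 2} (hfV : IsNewformOf V f) (hfV' : IsNewformOf V' f')
    (hV' : ∀ n : ℕ, cuspCoeff f' n = κ (n : ZMod _) * cuspCoeff f n)
    {Car : ℝ} {G : PowerSeries ℂ_[2]}
    (hG : ChiLineInterpolation ι K f (ι (((unitRoot V 2 : ℚ_[2]) : PadicAlgCl 2)))
      (baseChangeDirichlet K (ZMod.χ₈.ringHomComp (Int.castRingHom ℂ))) 𝔭 𝔭' Car G) :
    PowerSeries.coeff 1 G =
      -(((ι.symm ((splitLocalConstant 2 : ℂ) * (Car : ℂ) * (plusPeriod f : ℂ) * (plusPeriod f' : ℂ)) :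
          PadicAlgCl 2) : ℂ_[2]) *
        algebraMap ℚ_[2] ℂ_[2] (∑' k : ℕ, PowerSeries.coeff k
          (padicLFunction f (unitRoot V 2 : ℚ_[2]) * padicLFunction f' (unitRoot V 2 : ℚ_[2])) *
            (k : ℚ_[2]) * (-2) ^ (k - 1))) := by
  obtain ⟨H, hGH, -, hH1, -⟩ := chi8Line_eq_C_mul_map ι K h2 hsplit 𝔭 𝔭' h𝔭 h𝔭' κ hκ hκ2 hd V V' hordV
    hordV' hap hN hfV hfV' hV' hG
  rw [hGH, PowerSeries.coeff_C_mul, PowerSeries.coeff_map, ← hH1.tsum_eq, tsum_neg, map_neg, mul_neg]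

/-- ★★ **The rank-one leading coefficient: `[T¹]G = −c · L₂′(E, −2) · L₂(E′, −2)` when `L₂(E, −2) = 0`.**
In the setting of `chi8Line_eq_C_mul_map`, if the `2`-adic `L`-function of `E` vanishes at the
conductor-`8` point (`Σ_k [T^k]L₂(E,T)·(−2)^k = 0`; e.g. forced by the sign when `L(E^{(2)}, 1) = 0`,
`hasSum_coeff_padicLFunction_two_neg_two_zero`), then the first coefficient of Disegni's function on
the `χ₈∘N`-line is `−c · (Σ_k k·[T^k]L₂(E,T)·(−2)^{k−1}) · (Σ_k [T^k]L₂(E′,T)·(−2)^k)` — Leibniz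
(`PowerSeries.derivativeFun_mul`) for `P = L₂(E,·)·L₂(E′,·)` evaluated at `−2`
(`MemIwasawaRat.hasSum_eval_mul`), the term `L₂(E,−2)·L₂′(E′,−2)` vanishing. In valuations:
«`ord₂ [T¹]G = ord₂ c + D + a`», `D = ord₂ L₂′(E,−2)`, `a = ord₂ L₂(E′,−2)` (cell PREGRADE §5).
[cite: Disegni2017, Theorem A/B (arXiv v3 PDF pp. 6–9)] [cite: MazurTateTeitelbaum1986Invent, §I.13–I.14]
[cite: PerrinRiou1987, (1.1) (p. 459)] -/
theorem coeff_one_chi8Line_eq_of_hasSum_zero (h2 : Module.finrank ℚ K = 2)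
    (hsplit : ((Ideal.span {(2 : ℤ)}).primesOver (𝓞 K)).ncard = 2)
    (𝔭 𝔭' : HeightOneSpectrum (𝓞 K)) (h𝔭 : ((2 : ℕ) : 𝓞 K) ∈ 𝔭.asIdeal)
    (h𝔭' : ((2 : ℕ) : 𝓞 K) ∈ 𝔭'.asIdeal)
    (κ : DirichletCharacter ℂ (NumberField.discr K).natAbs)
    (hκ : ∀ ℓ : ℕ, ℓ.Prime → ℓ ≠ 2 → κ ℓ = (jacobiSym (NumberField.discr K) ℓ : ℂ))
    (hκ2 : κ 2 = if NumberField.discr K % 8 = 1 then 1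
        else if NumberField.discr K % 8 = 5 then -1 else 0)
    (hd : Nat.Coprime 2 (NumberField.discr K).natAbs)
    (V V' : WeierstrassCurve ℚ) [V.IsElliptic] [V.IsGloballyMinimal] [V'.IsElliptic] [V'.IsGloballyMinimal]
    (hordV : IsOrdinaryAt V 2) (hordV' : IsOrdinaryAt V' 2) (hap : V'.frobeniusTrace 2 = V.frobeniusTrace 2)
    {N N' : ℕ} [NeZero N] [NeZero N'] (hN : ¬ 2 ∣ N) {f : CuspForm (Gamma0 N) 2}
    {f' : CuspForm (Gamma0 N') 2} (hfV : IsNewformOf V f) (hfV' : IsNewformOf V' f')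
    (hV' : ∀ n : ℕ, cuspCoeff f' n = κ (n : ZMod _) * cuspCoeff f n)
    {Car : ℝ} {G : PowerSeries ℂ_[2]}
    (hG : ChiLineInterpolation ι K f (ι (((unitRoot V 2 : ℚ_[2]) : PadicAlgCl 2)))
      (baseChangeDirichlet K (ZMod.χ₈.ringHomComp (Int.castRingHom ℂ))) 𝔭 𝔭' Car G)
    (h0 : HasSum (fun k : ℕ ↦ PowerSeries.coeff k (padicLFunction f (unitRoot V 2 : ℚ_[2])) *
      (-2 : ℚ_[2]) ^ k) 0) :
    PowerSeries.coeff 1 G =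
      -(((ι.symm ((splitLocalConstant 2 : ℂ) * (Car : ℂ) * (plusPeriod f : ℂ) * (plusPeriod f' : ℂ)) :
          PadicAlgCl 2) : ℂ_[2]) *
        algebraMap ℚ_[2] ℂ_[2] (∑' k : ℕ, PowerSeries.coeff k (padicLFunction f (unitRoot V 2 : ℚ_[2])) *
          (k : ℚ_[2]) * (-2) ^ (k - 1)) *
        algebraMap ℚ_[2] ℂ_[2] (∑' k : ℕ, PowerSeries.coeff k (padicLFunction f' (unitRoot V 2 : ℚ_[2])) *
          (-2) ^ k)) := by
  obtain ⟨H, hGH, -, hH1, -⟩ := chi8Line_eq_C_mul_map ι K h2 hsplit 𝔭 𝔭' h𝔭 h𝔭' κ hκ hκ2 hd V V' hordV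
    hordV' hap hN hfV hfV' hV' hG
  set α : ℚ_[2] := (unitRoot V 2 : ℚ_[2]) with hαdef
  set B₁ := padicLFunction f α with hB₁
  set B₂ := padicLFunction f' α with hB₂
  set ι₂ := algebraMap ℚ_[2] ℂ_[2] with hι₂
  set a : ℚ_[2] := -2 with ha
  have ha1 : ‖a‖ < 1 := norm_neg_two_lt_one'
  have hα' : (unitRoot V' 2 : ℚ_[2]) = α := by
    rw [hαdef, show unitRoot V' 2 = unitRoot V 2 by unfold unitRoot; rw [hap]]
  -- bounds and `Λ ⊗ ℚ₂`-membership of the four series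
  obtain ⟨C₁, hC₁⟩ := exists_forall_norm_coeff_padicLFunction_le (f := f) hordV hfV
  obtain ⟨C₂, hC₂⟩ := exists_forall_norm_coeff_padicLFunction_le (f := f') hordV' hfV'
  rw [hα'] at hC₂
  have hD₁b := norm_coeff_derivativeFun_le hC₁
  have hD₂b := norm_coeff_derivativeFun_le hC₂
  have hM₁ : MemIwasawaRat 2 B₁ := memIwasawaRat_of_forall_norm_coeff_le hC₁
  have hM₂ : MemIwasawaRat 2 B₂ := memIwasawaRat_of_forall_norm_coeff_le hC₂
  have hMD₁ : MemIwasawaRat 2 B₁.derivativeFun := memIwasawaRat_of_forall_norm_coeff_le hD₁b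
  have hMD₂ : MemIwasawaRat 2 B₂.derivativeFun := memIwasawaRat_of_forall_norm_coeff_le hD₂b
  -- the four evaluations at `a = −2` in `ℚ₂`
  have hs₂ := (summable_coeff_mul_pow_of_le hC₂ ha1).hasSum
  have hd₁ := (summable_coeff_mul_pow_of_le hD₁b ha1).hasSum
  have hd₂ := (summable_coeff_mul_pow_of_le hD₂b ha1).hasSum
  -- in `ℂ₂`
  have hz : ‖ι₂ a‖ < 1 := by rw [hι₂, norm_algebraMap']; exact ha1
  have hv₁ := hasSum_algebraMap_coeff_mul_pow h0
  have hv₂ := hasSum_algebraMap_coeff_mul_pow hs₂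
  have hw₁ := hasSum_algebraMap_coeff_mul_pow hd₁
  have hw₂ := hasSum_algebraMap_coeff_mul_pow hd₂
  rw [map_zero] at hv₁
  -- Leibniz: `P′ = B₁ • B₂′ + B₂ • B₁′`, evaluated at `a`
  have hP₁ := MemIwasawaRat.hasSum_eval_mul hM₁ hMD₂ hz hv₁ hw₂
  have hP₂ := MemIwasawaRat.hasSum_eval_mul hM₂ hMD₁ hz hv₂ hw₁
  have hDP : HasSum (fun k : ℕ ↦ ι₂ (PowerSeries.coeff k (B₁ * B₂).derivativeFun) * (ι₂ a) ^ k)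
      (0 * ι₂ (∑' n : ℕ, PowerSeries.coeff n B₂.derivativeFun * a ^ n) +
        ι₂ (∑' n : ℕ, PowerSeries.coeff n B₂ * a ^ n) *
          ι₂ (∑' n : ℕ, PowerSeries.coeff n B₁.derivativeFun * a ^ n)) := by
    rw [PowerSeries.derivativeFun_mul, smul_eq_mul, smul_eq_mul]
    refine (hP₁.add hP₂).congr_fun fun k ↦ ?_
    rw [map_add, map_add, add_mul]
  -- the same evaluation from the re-centring: `Σ_n [Tⁿ]P′ aⁿ = Σ_k k P_k a^{k−1} = −[T¹]H`
  have hH1' : HasSum (fun n : ℕ ↦ PowerSeries.coeff n (B₁ * B₂).derivativeFun * a ^ n)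
      (-PowerSeries.coeff 1 H) := by
    rw [hasSum_derivativeFun_iff]
    have h := hH1.neg
    simp only [neg_neg] at h
    exact h
  have hDP' := hasSum_algebraMap_coeff_mul_pow hH1'
  have huniq := hDP'.unique hDP
  rw [zero_mul, zero_add, map_neg, neg_eq_iff_eq_neg] at huniq
  rw [← hι₂] at huniq
  -- `[T¹]G = c · ι₂([T¹]H)`
  rw [hGH, PowerSeries.coeff_C_mul, PowerSeries.coeff_map, huniq,
    (hasSum_derivativeFun_iff.mp hd₁).tsum_eq]
  ring

/-- ★★★ **Road-(C) form, all binders from the curve** (`d* = 2`): for `E = V/ℚ` globally minimal and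
good ORDINARY at `2` with newform `f`, its twist `E′ = V′` by `d_K` (good ordinary at `2`, same `a₂`,
newform `f′` with `a_n(f′) = κ_K(n)a_n(f)`), `K` quadratic with `(2, d_K) = 1` and `2` split, and `G`
Disegni's function on the line through `χ₈∘N_{K/ℚ}` for `(f, a = ι(unitRoot V 2))`: if `L₂(E, −2) = 0`
then `[T¹]G = −c · L₂′(E, −2) · L₂(E′, −2)`, `c = ι⁻¹(u·Car·Ω⁺_f·Ω⁺_{f′})` — the level binder `2 ∤ N`
discharged by `not_two_dvd_level_of_isOrdinaryAt`. For the crux's class `W = 49a1^{(2d′)}`,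
`d′ ≡ 1 (4)`: `E = 49a1^{(d′)}`, `W = E ⊗ χ₈`, and `L₂(E,−2) = 0` is the sign-forced zero
(`hasSum_coeff_padicLFunction_two_neg_two_zero`, `ord_{s=1}L(W,s) = 1` odd).
[cite: Disegni2017, Theorem A/B (arXiv v3 PDF pp. 6–9)] [cite: MazurTateTeitelbaum1986Invent, §I.13–I.14]
[cite: PerrinRiou1987, (1.1) (p. 459)] -/
theorem coeff_one_chi8Line_eq_of_hasSum_zero' (h2 : Module.finrank ℚ K = 2)
    (hsplit : ((Ideal.span {(2 : ℤ)}).primesOver (𝓞 K)).ncard = 2)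
    (𝔭 𝔭' : HeightOneSpectrum (𝓞 K)) (h𝔭 : ((2 : ℕ) : 𝓞 K) ∈ 𝔭.asIdeal)
    (h𝔭' : ((2 : ℕ) : 𝓞 K) ∈ 𝔭'.asIdeal)
    (κ : DirichletCharacter ℂ (NumberField.discr K).natAbs)
    (hκ : ∀ ℓ : ℕ, ℓ.Prime → ℓ ≠ 2 → κ ℓ = (jacobiSym (NumberField.discr K) ℓ : ℂ))
    (hκ2 : κ 2 = if NumberField.discr K % 8 = 1 then 1
        else if NumberField.discr K % 8 = 5 then -1 else 0)
    (hd : Nat.Coprime 2 (NumberField.discr K).natAbs)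
    (V V' : WeierstrassCurve ℚ) [V.IsElliptic] [V.IsGloballyMinimal] [V'.IsElliptic] [V'.IsGloballyMinimal]
    (hordV : IsOrdinaryAt V 2) (hordV' : IsOrdinaryAt V' 2) (hap : V'.frobeniusTrace 2 = V.frobeniusTrace 2)
    {N N' : ℕ} [NeZero N] [NeZero N'] {f : CuspForm (Gamma0 N) 2}
    {f' : CuspForm (Gamma0 N') 2} (hfV : IsNewformOf V f) (hfV' : IsNewformOf V' f')
    (hV' : ∀ n : ℕ, cuspCoeff f' n = κ (n : ZMod _) * cuspCoeff f n)
    {Car : ℝ} {G : PowerSeries ℂ_[2]}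
    (hG : ChiLineInterpolation ι K f (ι (((unitRoot V 2 : ℚ_[2]) : PadicAlgCl 2)))
      (baseChangeDirichlet K (ZMod.χ₈.ringHomComp (Int.castRingHom ℂ))) 𝔭 𝔭' Car G)
    (h0 : HasSum (fun k : ℕ ↦ PowerSeries.coeff k (padicLFunction f (unitRoot V 2 : ℚ_[2])) *
      (-2 : ℚ_[2]) ^ k) 0) :
    PowerSeries.coeff 1 G =
      -(((ι.symm ((splitLocalConstant 2 : ℂ) * (Car : ℂ) * (plusPeriod f : ℂ) * (plusPeriod f' : ℂ)) :
          PadicAlgCl 2) : ℂ_[2]) *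
        algebraMap ℚ_[2] ℂ_[2] (∑' k : ℕ, PowerSeries.coeff k (padicLFunction f (unitRoot V 2 : ℚ_[2])) *
          (k : ℚ_[2]) * (-2) ^ (k - 1)) *
        algebraMap ℚ_[2] ℂ_[2] (∑' k : ℕ, PowerSeries.coeff k (padicLFunction f' (unitRoot V 2 : ℚ_[2])) *
          (-2) ^ k)) :=
  coeff_one_chi8Line_eq_of_hasSum_zero ι K h2 hsplit 𝔭 𝔭' h𝔭 h𝔭' κ hκ hκ2 hd V V' hordV hordV' hap
    (not_two_dvd_level_of_isOrdinaryAt hfV hordV) hfV hfV' hV' hG h0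

end LeadingCoeff

end Summit.BirchSwinnertonDyer.BirchSwinnertonDyer.Theorems.PrintCf2.DisegniPairTwo

end
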